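/-
Copyright (c) 2026 the pub-hodgecm-mathlib formalisation cell (harness21).  Prover seat hodgecm-mathlib-LH4-p02 (g7) on planner LH4-plan (g6) WORD #11 «ARTIN–SCHREIER
RELATIVE TRACE, CHARACTERISTIC 2» (2026-09-02) — the finite-field heart of B-p04 (g47)'s (W3a) «an `L⁺_v`-class non-square in `L_w` is ramified-type at an inert place».
-/
import Literature.FieldTheory.FiniteFields.TracesAndNorms   -- ★ LN Def. 2.22 `algebraMap_absTrace_eq_sum_pow`, Thm. 2.25 `trace_eq_zero_iff_exists_pow_card_sub` (brings Mathlib)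
import HarnessLib

/-!
# Artin–Schreier over `𝔽₂` in a quadratic extension of finite fields of characteristic `2`: `𝔽_q ⊆ ℘(𝔽_{q²})`, and `Tr_{𝔽_{q²}∕𝔽_q} ρ ∈ ℘(𝔽_q) ⇒ ρ ∈ ℘(𝔽_{q²})`
# (Lidl–Niederreiter 1997, Thm. 2.25 over the prime field; the relative statements by the transitivity of the trace, Thm. 2.26)

Topic `FieldTheory/FiniteFields`; namespace `Literature.FieldTheory.FiniteFields`.  THEOREMS ONLY (no definition, no instance, no notation, no named fact, no `sorry`);
count-neutral; kernel lane `--supports stmt-HodgeConjecture-24833`.  Cell `pub/hodgecm-mathlib` (D-0151), crux H413 = `stmt-HodgeConjecture-24833`, half A line LH4 (row #183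
«LT-DYADIC»): this is the residue-field step of B-p04 (g47)'s (W3a) `LocalFields/UnramifiedQuadraticFixedClassSquare` («a `σ_w`-fixed `a` in the unramified-or-square class of
`L_w` is a square», inert place `v ∣ 2`), in its NORM route (n3) («`ρ̄ + ρ̄^q = τ̄² + τ̄` with `τ̄ ∈ 𝔽_q` ⇒ `ρ̄ ∈ ℘(𝔽_{q²})`»).  HONEST STATUS: NO consumer in the cell today — (W3a) went by its
DESCENT route, whose step (iv) «`𝔽_q ⊆ ℘(𝔽_{q²})`» ((T1) below) is B-p04's own ★ `UnramifiedQuadraticNorm.exists_mul_self_add_self_eq_of_frobenius_eq` (§0 of that file, with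
`σ = (·)^q`; NOT restated here); this file is banked as the relative Artin–Schreier layer for dyadic inert places (planner LH4-plan (g6) WORD #13).  Pays no organ, opens no road.  HONEST LABEL: HC_CM is proved only modulo the 7 printed citations (2 remaining:
hLiu418 = stmt-HodgeConjecture-24832, h413 = stmt-HodgeConjecture-24833) until rung 0 closes.

CURRENCY (the consumer's, ★ `UnitaryLatticeTreeValencyInertPlace.fintypeCard_valuedResidueField_eq_sq_of_inert` ∕ `residueHom_galAdicCompletionMap_eq_pow_valued`): `k` a field with
ANY `[Fintype k]`, `h2 : (2 : k) = 0`, a bare `q : ℕ` with `hk : Fintype.card k = q ^ 2` (so `q = 2^f`, DERIVED here: `exists_eq_two_pow_of_card_eq_sq`), «`y ∈ 𝔽_q`» := `y ^ q = y`,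
the relative trace `y + y ^ q`, the Artin–Schreier map `℘ x = x·x + x`; no subfield, no `Algebra K k` in any statement (inside the proofs: `CharP k 2`, Mathlib's non-instance
`ZMod.algebra k 2`, and the absolute trace `Tr_{k∕𝔽₂} = Σ_{i<n} (·)^{2^i}`).

THE MATHEMATICS (`card k = 2^{2f}`, `q = 2^f`).  (T0) `β ∈ ℘(k) ⟺ Tr_{k∕𝔽₂} β = Σ_{i<2f} β^{2^i} = 0` (★ LN Thm. 2.25 at `K = 𝔽₂` + Def. 2.22).  SPLIT: `Σ_{i<2f} ρ^{2^i} =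
Σ_{i<f} (ρ + ρ^q)^{2^i}` (Frobenius is additive) — the transitivity `Tr_{k∕𝔽₂} = Tr_{𝔽_q∕𝔽₂} ∘ Tr_{k∕𝔽_q}` written out.  TELESCOPE: `Σ_{i<f} (τ² + τ)^{2^i} = τ^{q} + τ` (`2 = 0`).
Hence (T2): `ρ + ρ^q = τ² + τ` with `τ^q = τ` gives `Tr_{k∕𝔽₂} ρ = τ^q + τ = 2τ = 0`, so `ρ = x² + x`; (T1) «`𝔽_q ⊆ ℘(𝔽_{q²})`» is (T2) at `τ = 0` (`β^q = β ⇒ β + β^q = 2β = 0`)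
and is ★ B-p04's `exists_mul_self_add_self_eq_of_frobenius_eq` (not here).  Conversely (T3): `℘(x) + ℘(x)^q = ℘(x + x^q)` and `(y + y^q)^q = y + y^q`, so
`Tr_{k∕𝔽_q} ℘(k) = ℘(𝔽_q)` exactly (T2′).

* §0 char-2 ∕ cardinality plumbing: `charP_two_of_two_eq_zero`, `exists_eq_two_pow_of_card_eq_sq` (every dyadic inert-place file needs it).
* §1 (T0) `exists_mul_self_add_self_eq_iff_sum_pow_two_pow_eq_zero`, SPLIT `sum_range_two_mul_pow_two_pow_eq`, TELESCOPE `sum_range_mul_self_add_self_pow_two_pow`.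
* §2 (T2) `exists_mul_self_add_self_eq_of_add_pow_eq`, (T3) `add_pow_pow_eq_of_card_eq_sq`, `mul_self_add_self_add_pow_eq_of_card_eq_sq`,
  (T2′) `exists_add_pow_eq_mul_self_add_self_of_exists`.

## References
* [LidlNiederreiter1996] R. Lidl, H. Niederreiter, *Finite Fields*, 2nd ed. (1997), Ch. 2 §3: Definition 2.22, Theorem 2.23 (v), Theorem 2.25, Theorem 2.26.
* [Serre1979] J.-P. Serre, *Local Fields*, GTM 67 (1979), Ch. XIV §4 Exercise (the Artin–Schreier symbol at `p = 2`); Ch. V §3.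
-/

set_option autoImplicit false

open Finset

namespace Literature.FieldTheory.FiniteFields

section CharTwo

variable {k : Type*} [Field k]

/-! ## §0 Characteristic-`2` and cardinality plumbing -/

/-- `2 = 0` in a field gives `CharP k 2`. [cite: LidlNiederreiter1996, Theorem 2.25 (setting)] -/
theorem charP_two_of_two_eq_zero (h2 : (2 : k) = 0) : CharP k 2 :=
  (CharP.charP_iff_prime_eq_zero Nat.prime_two).mpr (by exact_mod_cast h2)

variable [Fintype k]

/-- **`card k = q²` in characteristic `2` forces `q = 2^f` and `card k = 2^{2f}`.** [cite: LidlNiederreiter1996, Theorem 2.25 (setting)] -/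
theorem exists_eq_two_pow_of_card_eq_sq (h2 : (2 : k) = 0) {q : ℕ} (hk : Fintype.card k = q ^ 2) : ∃ f : ℕ, q = 2 ^ f ∧ Fintype.card k = 2 ^ (2 * f) := by
  haveI : CharP k 2 := charP_two_of_two_eq_zero h2
  obtain ⟨n, -, hn⟩ := FiniteField.card k 2
  have hq : q ∣ 2 ^ (n : ℕ) := by
    rw [← hn, hk, pow_two]
    exact dvd_mul_right q q
  obtain ⟨f, -, rfl⟩ := (Nat.dvd_prime_pow Nat.prime_two).1 hq
  refine ⟨f, rfl, ?_⟩
  rw [hk, ← pow_mul, mul_comm]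

/-! ## §1 Artin–Schreier over `𝔽₂` by the absolute trace; the split and the telescope -/

/-- **(T0) ARTIN–SCHREIER OVER `𝔽₂`**: in a finite field `k` of characteristic `2` with `2^n` elements, `β = x·x + x` is solvable iff `Σ_{i<n} β^{2^i} = 0` — ★ LN Thm. 2.25
`trace_eq_zero_iff_exists_pow_card_sub` at `K = 𝔽₂` (`Tr_{k∕𝔽₂} β = 0 ↔ β = x² − x`) with the absolute trace written as the Frobenius power sum (★ Def. 2.22
`algebraMap_absTrace_eq_sum_pow`). [cite: LidlNiederreiter1996, Theorem 2.25] [cite: LidlNiederreiter1996, Definition 2.22] -/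
theorem exists_mul_self_add_self_eq_iff_sum_pow_two_pow_eq_zero (h2 : (2 : k) = 0) {n : ℕ} (hn : Fintype.card k = 2 ^ n) (β : k) :
    (∃ x : k, x * x + x = β) ↔ ∑ i ∈ range n, β ^ 2 ^ i = 0 := by
  haveI : CharP k 2 := charP_two_of_two_eq_zero h2
  letI : Algebra (ZMod 2) k := ZMod.algebra k 2
  have hfin : Module.finrank (ZMod 2) k = n := by
    have h := Module.card_eq_pow_finrank (K := ZMod 2) (V := k)
    rw [hn, ZMod.card] at h
    exact (Nat.pow_right_injective le_rfl h).symm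
  calc (∃ x : k, x * x + x = β) ↔ ∃ x : k, β = x ^ Fintype.card (ZMod 2) - x := by
        refine exists_congr fun x => ?_
        rw [ZMod.card, CharTwo.sub_eq_add, pow_two, eq_comm]
    _ ↔ Algebra.trace (ZMod 2) k β = 0 := (TracesAndNorms.trace_eq_zero_iff_exists_pow_card_sub (ZMod 2) k β).symm
    _ ↔ algebraMap (ZMod 2) k (Algebra.trace (ZMod 2) k β) = 0 := (map_eq_zero_iff _ (algebraMap (ZMod 2) k).injective).symm
    _ ↔ ∑ i ∈ range n, β ^ 2 ^ i = 0 := by rw [TracesAndNorms.algebraMap_absTrace_eq_sum_pow k 2 β, hfin]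

omit [Fintype k] in
/-- **SPLIT (transitivity of the trace, written out)**: `Σ_{i<2f} ρ^{2^i} = Σ_{i<f} (ρ + ρ^{2^f})^{2^i}` in characteristic `2` (Frobenius is additive: `(ρ + ρ^q)^{2^i} = ρ^{2^i} +
ρ^{2^{f+i}}`). [cite: LidlNiederreiter1996, Theorem 2.26] -/
theorem sum_range_two_mul_pow_two_pow_eq (h2 : (2 : k) = 0) (f : ℕ) (ρ : k) :
    ∑ i ∈ range (2 * f), ρ ^ 2 ^ i = ∑ i ∈ range f, (ρ + ρ ^ 2 ^ f) ^ 2 ^ i := by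
  haveI : CharP k 2 := charP_two_of_two_eq_zero h2
  rw [two_mul, Finset.sum_range_add, ← Finset.sum_add_distrib]
  refine Finset.sum_congr rfl fun i _ => ?_
  rw [add_pow_char_pow, ← pow_mul, ← pow_add]

omit [Fintype k] in
/-- **TELESCOPE**: `Σ_{i<f} (τ·τ + τ)^{2^i} = τ^{2^f} + τ` in characteristic `2` (`(τ² + τ)^{2^i} = τ^{2^{i+1}} + τ^{2^i}` and the middle terms cancel in pairs).
[cite: LidlNiederreiter1996, Theorem 2.23 (v)] -/
theorem sum_range_mul_self_add_self_pow_two_pow (h2 : (2 : k) = 0) (f : ℕ) (τ : k) :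
    ∑ i ∈ range f, (τ * τ + τ) ^ 2 ^ i = τ ^ 2 ^ f + τ := by
  haveI : CharP k 2 := charP_two_of_two_eq_zero h2
  induction f with
  | zero => rw [Finset.sum_range_zero, pow_zero, pow_one, CharTwo.add_self_eq_zero]
  | succ f ih =>
    have hsq : (τ * τ) ^ 2 ^ f = τ ^ 2 ^ (f + 1) := by rw [← pow_two, ← pow_mul, ← pow_succ']
    have h0 : τ ^ 2 ^ f + τ ^ 2 ^ f = 0 := CharTwo.add_self_eq_zero _
    rw [Finset.sum_range_succ, ih, add_pow_char_pow, hsq]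
    linear_combination h0

/-! ## §2 The relative statements for `𝔽_{q²} ∕ 𝔽_q` -/

/-- **(T2) `Tr_{𝔽_{q²}∕𝔽_q} ρ ∈ ℘(𝔽_q) ⇒ ρ ∈ ℘(𝔽_{q²})`**: `k` finite of characteristic `2` with `card k = q²`; if `ρ + ρ^q = τ·τ + τ` for some `τ` with `τ^q = τ`, then `ρ = x·x + x`
for some `x ∈ k` (`Tr_{k∕𝔽₂} ρ = Σ_{i<f}(τ² + τ)^{2^i} = τ^q + τ = 2τ = 0`, then (T0)).  The norm route's step (n3). [cite: LidlNiederreiter1996, Theorem 2.25] [cite: LidlNiederreiter1996, Theorem 2.26] -/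
theorem exists_mul_self_add_self_eq_of_add_pow_eq (h2 : (2 : k) = 0) {q : ℕ} (hk : Fintype.card k = q ^ 2) {ρ τ : k} (hτ : τ ^ q = τ)
    (h : ρ + ρ ^ q = τ * τ + τ) : ∃ x : k, x * x + x = ρ := by
  haveI : CharP k 2 := charP_two_of_two_eq_zero h2
  obtain ⟨f, rfl, hkf⟩ := exists_eq_two_pow_of_card_eq_sq h2 hk
  rw [exists_mul_self_add_self_eq_iff_sum_pow_two_pow_eq_zero h2 hkf, sum_range_two_mul_pow_two_pow_eq h2, h,
    sum_range_mul_self_add_self_pow_two_pow h2, hτ, CharTwo.add_self_eq_zero]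

/-- **(T3) the relative trace lands in `𝔽_q`**: `(y + y^q)^q = y + y^q` (`y^{q²} = y`). [cite: LidlNiederreiter1996, Theorem 2.23 (v)] -/
theorem add_pow_pow_eq_of_card_eq_sq (h2 : (2 : k) = 0) {q : ℕ} (hk : Fintype.card k = q ^ 2) (y : k) : (y + y ^ q) ^ q = y + y ^ q := by
  haveI : CharP k 2 := charP_two_of_two_eq_zero h2
  obtain ⟨f, rfl, -⟩ := exists_eq_two_pow_of_card_eq_sq h2 hk
  rw [add_pow_char_pow, ← pow_mul, ← pow_two, ← hk, FiniteField.pow_card, add_comm]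

/-- **(T3) `℘` commutes with the relative trace**: `(x·x + x) + (x·x + x)^q = (x + x^q)·(x + x^q) + (x + x^q)` in characteristic `2`.
[cite: LidlNiederreiter1996, Theorem 2.23 (v)] -/
theorem mul_self_add_self_add_pow_eq_of_card_eq_sq (h2 : (2 : k) = 0) {q : ℕ} (hk : Fintype.card k = q ^ 2) (x : k) :
    (x * x + x) + (x * x + x) ^ q = (x + x ^ q) * (x + x ^ q) + (x + x ^ q) := by
  haveI : CharP k 2 := charP_two_of_two_eq_zero h2
  obtain ⟨f, rfl, -⟩ := exists_eq_two_pow_of_card_eq_sq h2 hk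
  rw [add_pow_char_pow, mul_pow]
  linear_combination (-(x * x ^ 2 ^ f)) * h2

/-- **(T2′) the converse of (T2)**: if `ρ = x·x + x` then `ρ + ρ^q = τ·τ + τ` with `τ = x + x^q`, `τ^q = τ` — so `Tr_{𝔽_{q²}∕𝔽_q} ℘(𝔽_{q²}) = ℘(𝔽_q)` exactly.
[cite: LidlNiederreiter1996, Theorem 2.25] [cite: LidlNiederreiter1996, Theorem 2.26] -/
theorem exists_add_pow_eq_mul_self_add_self_of_exists (h2 : (2 : k) = 0) {q : ℕ} (hk : Fintype.card k = q ^ 2) {ρ : k} (hρ : ∃ x : k, x * x + x = ρ) :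
    ∃ τ : k, τ ^ q = τ ∧ ρ + ρ ^ q = τ * τ + τ := by
  obtain ⟨x, rfl⟩ := hρ
  exact ⟨x + x ^ q, add_pow_pow_eq_of_card_eq_sq h2 hk x, mul_self_add_self_add_pow_eq_of_card_eq_sq h2 hk x⟩

end CharTwo

end Literature.FieldTheory.FiniteFields
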